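import Literature.NumberTheory.Sieve.SmoothCountGaussShortInterval
import Literature.NumberTheory.Sieve.SmoothSaddleKernelWindow
import Literature.NumberTheory.Sieve.SmoothSaddleWindowHT
import Literature.NumberTheory.Sieve.SmoothZetaDecayNearAxisSaddle
import Literature.NumberTheory.LFunctions.PrimeReciprocalWindows
import HarnessLib

/-!
# The Gaussian-smoothed saddle-point evaluation of `Ψ(x, y)`: analytic core

Topic `Literature/NumberTheory/Sieve`; a PROVED tool file. Hildebrand–Tenenbaum [HildebrandTenenbaum1986, Thm 1] prove
`Ψ(x, y) = x^α ζ(α, y)/(α√(2πφ₂(α, y))) (1 + O(1/u + log y/y))` uniformly for `x ≥ y ≥ 2` (`α = α(x, y)` the saddle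
point, `u = log x/log y`), from a sharply truncated Perron formula at the height `T = Y(ε)`, which needs
Vinogradov's zero-free region (their Lemma 6). This file assembles the zero-free-region-FREE variant: Perron's
formula is replaced by its Gaussian regularisation at a width `T_g` (`GaussPerron.card_smooth_gaussPerron_integral`),
whose error is a Gaussian mean of `|ζ(α + it, y)|`; the integral `∫ e^{-t²/2T_g²} ζ(α+it, y) x^{it} dt/(α+it)` is
evaluated by the second-order window lemma (`norm_setIntegral_window_saddle_sub_main_le`) and the abstract-kernel
tail lemma (`SaddleKernel.norm_tailIntegral_le_window`), given decay of `ζ(α + it, y)` off the real axis as a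
hypothesis. The companion file `SmoothCountSaddleRegimeA` feeds in the elementary decay
`|ζ(α+it, y)| ≤ ζ(α, y)/(log x)³` and obtains Theorem 1 with error `O(1/u)` for `(log x)³ ≤ y`, `u ≥ (log log y)³`.

* `GaussSaddle.kernelA` — the kernel `A(t) = e^{-t²/2T²}/(α + it)` and its constants
  (`‖A‖ ≤ 1/α`, `‖A(t) - 1/α + it/α²‖ ≤ (1/α³ + 1/(2T²α)) t²`, `‖A(t)‖ ≤ (4T²/e) e^{-T₁²/4T²}/|t|³` for `|t| > T₁`);
* `GaussSaddle.integral_perronDamping_eq` — the Fourier integral of `card_smooth_gaussPerron_integral` is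
  `(ζ(α, y)/2π) ∫ exp(e(t)) A(t) dt`;
* `GaussSaddle.integral_norm_le` — the Gaussian mean of `|ζ(α + it, y)|` from three-zone bounds;
* `GaussSaddle.abs_rpow_mul_card_sub_main_le` — **the analytic core**:
  `|x^{-α}Ψ(x, y) - m| ≤ (α²/2T_g²)(m + Δ) + Δ + R`, `m = ζ(α, y)/(α√(2πφ))`;
* `GaussSaddle.window_bound_le`, `tail_bound_le`, `mean_bound_le` — with `T_g = u/4`, `W = √(140 log u)`,
  `T_d = (u/2)√(4 log u + 2 log log y + 2)`, `ε = (log x)^{-3}`, the window, tail and mean errors are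
  `O(1/(α√φ u))` resp. `O(m/u)`, with explicit constants.

## References

* [HildebrandTenenbaum1986] A. Hildebrand, G. Tenenbaum, Trans. AMS 296 (1986) 265–290, Thm 1 and §4 (Lemmas
  9–11) (held: `paper:doi-10-1090-s0002-9947-1986-0837811-1`, pp. 266, 277–281).
-/

noncomputable section

open Complex MeasureTheory Real Set Filter

namespace Literature.NumberTheory.Sieve

namespace GaussSaddle

variable {α T t x : ℝ} {y : ℕ}

/-! ### The kernel `A(t) = e^{-t²/2T²}/(α + it)` -/

/-- `A(t) = e^{-t²/(2T²)} (α + it)⁻¹`. [cite: HildebrandTenenbaum1986, §4 Lemma 9 (the Gaussian factor)] -/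
def kernelA (α T t : ℝ) : ℂ :=
  ((Real.exp (-(t ^ 2 / (2 * T ^ 2))) : ℝ) : ℂ) * ((α : ℂ) + t * I)⁻¹

/-- `A(0) = 1/α`. [folklore] -/
theorem kernelA_zero (α T : ℝ) : kernelA α T 0 = (α : ℂ)⁻¹ := by
  simp [kernelA]

/-- `A` is continuous (`α > 0`). [folklore] -/
theorem continuous_kernelA (hα : 0 < α) (T : ℝ) : Continuous (kernelA α T) := by
  unfold kernelA
  refine Continuous.mul (by fun_prop) ?_
  exact Continuous.inv₀ (by fun_prop) fun t => SaddleWindow.add_mul_I_ne_zero hα t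

/-- `‖(α + it)⁻¹‖ ≤ 1/α`. [folklore] -/
theorem norm_inv_add_mul_I_le (hα : 0 < α) (t : ℝ) : ‖((α : ℂ) + t * I)⁻¹‖ ≤ α⁻¹ := by
  rw [norm_inv]
  exact inv_anti₀ hα (SaddleWindow.le_norm_add_mul_I hα.le t)

/-- `‖(α + it)⁻¹‖ ≤ 1/|t|` (`t ≠ 0`). [folklore] -/
theorem norm_inv_add_mul_I_le_abs (α : ℝ) (ht : t ≠ 0) : ‖((α : ℂ) + t * I)⁻¹‖ ≤ |t|⁻¹ := by
  rw [norm_inv]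
  have h : |t| ≤ ‖(α : ℂ) + t * I‖ := by
    have := Complex.abs_im_le_norm ((α : ℂ) + t * I)
    simpa using this
  exact inv_anti₀ (abs_pos.2 ht) h

/-- `‖A(t)‖ = e^{-t²/2T²} ‖(α + it)⁻¹‖`. [folklore] -/
theorem norm_kernelA (α T t : ℝ) : ‖kernelA α T t‖ = Real.exp (-(t ^ 2 / (2 * T ^ 2))) * ‖((α : ℂ) + t * I)⁻¹‖ := by
  rw [kernelA, norm_mul, Complex.norm_real, Real.norm_eq_abs, abs_of_pos (Real.exp_pos _)]

/-- `‖A(t)‖ ≤ e^{-t²/2T²}/α ≤ 1/α`. [folklore] -/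
theorem norm_kernelA_le_exp_div (hα : 0 < α) (T t : ℝ) : ‖kernelA α T t‖ ≤ Real.exp (-(t ^ 2 / (2 * T ^ 2))) / α := by
  rw [norm_kernelA, div_eq_mul_inv]
  exact mul_le_mul_of_nonneg_left (norm_inv_add_mul_I_le hα t) (Real.exp_pos _).le

/-- `‖A(t)‖ ≤ 1/α`. [folklore] -/
theorem norm_kernelA_le (hα : 0 < α) (T t : ℝ) : ‖kernelA α T t‖ ≤ 1 / α := by
  refine (norm_kernelA_le_exp_div hα T t).trans (div_le_div_of_nonneg_right ?_ hα.le)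
  exact Real.exp_le_one_iff.2 (neg_nonpos.2 (by positivity))

/-- `A` is integrable (`α, T > 0`). [folklore] -/
theorem integrable_kernelA (hα : 0 < α) (hT : 0 < T) : Integrable (kernelA α T) := by
  have hg : Integrable fun t : ℝ => Real.exp (-(1 / (2 * T ^ 2)) * t ^ 2) / α :=
    (integrable_exp_neg_mul_sq (by positivity)).div_const α
  refine hg.mono (continuous_kernelA hα T).aestronglyMeasurable (Eventually.of_forall fun t => ?_)
  rw [Real.norm_eq_abs, abs_of_nonneg (by positivity)]
  have := norm_kernelA_le_exp_div hα T t
  rwa [show -(t ^ 2 / (2 * T ^ 2)) = -(1 / (2 * T ^ 2)) * t ^ 2 by ring] at this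

/-- **The kernel at second order**: `‖A(t) - 1/α - (-i/α²) t‖ ≤ (1/α³ + 1/(2T²α)) t²`. [folklore] -/
theorem norm_kernelA_sub_taylor_le (hα : 0 < α) (hT : 0 < T) (t : ℝ) :
    ‖kernelA α T t - (α : ℂ)⁻¹ - (-I / (α : ℂ) ^ 2) * t‖ ≤ (1 / α ^ 3 + 1 / (2 * T ^ 2 * α)) * t ^ 2 := by
  set e : ℝ := Real.exp (-(t ^ 2 / (2 * T ^ 2))) with he
  have hsplit : kernelA α T t - (α : ℂ)⁻¹ - (-I / (α : ℂ) ^ 2) * t =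
      (((e - 1 : ℝ)) : ℂ) * ((α : ℂ) + t * I)⁻¹ + (((α : ℂ) + t * I)⁻¹ - (α : ℂ)⁻¹ - (-I / (α : ℂ) ^ 2) * t) := by
    rw [kernelA, ← he]; push_cast; ring
  rw [hsplit]
  refine (norm_add_le _ _).trans ?_
  have he1 : e ≤ 1 := by rw [he]; exact Real.exp_le_one_iff.2 (neg_nonpos.2 (by positivity))
  have habs : |e - 1| = 1 - e := by rw [abs_sub_comm]; exact abs_of_nonneg (by linarith)
  have h1 : ‖(((e - 1 : ℝ)) : ℂ) * ((α : ℂ) + t * I)⁻¹‖ ≤ t ^ 2 / (2 * T ^ 2) * α⁻¹ := by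
    rw [norm_mul, Complex.norm_real, Real.norm_eq_abs, habs]
    refine mul_le_mul ?_ (norm_inv_add_mul_I_le hα t) (norm_nonneg _) (by positivity)
    rw [he]; exact LFunctions.PrimeReciprocal.one_sub_exp_neg_le _
  have h2 := SaddleWindow.norm_inv_sub_taylor_le hα t
  have : t ^ 2 / (2 * T ^ 2) * α⁻¹ + t ^ 2 / α ^ 3 = (1 / α ^ 3 + 1 / (2 * T ^ 2 * α)) * t ^ 2 := by
    field_simp; ring
  linarith

/-- `s e^{-cs} ≤ e^{-1}/c` (`c > 0`). [folklore] -/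
theorem mul_exp_neg_le (s : ℝ) {c : ℝ} (hc : 0 < c) : s * Real.exp (-(c * s)) ≤ Real.exp (-1) / c := by
  have h1 : c * s ≤ Real.exp (c * s - 1) := by have := Real.add_one_le_exp (c * s - 1); linarith
  rw [le_div_iff₀ hc, show Real.exp (c * s - 1) = Real.exp (c * s) * Real.exp (-1) by
    rw [← Real.exp_add]; ring_nf] at *
  rw [Real.exp_neg (c * s)]
  have h2 : 0 < Real.exp (c * s) := Real.exp_pos _
  calc s * (Real.exp (c * s))⁻¹ * c = (c * s) / Real.exp (c * s) := by field_simp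
    _ ≤ Real.exp (c * s) * Real.exp (-1) / Real.exp (c * s) := div_le_div_of_nonneg_right h1 h2.le
    _ = Real.exp (-1) := by field_simp

/-- **The kernel far out**: for `|t| > T₁ > 0`, `‖A(t)‖ ≤ (4T² e^{-1} e^{-T₁²/(4T²)})/|t|³`
(`t² e^{-t²/2T²} = (t² e^{-t²/4T²}) e^{-t²/4T²} ≤ (4T²/e) e^{-T₁²/4T²}`). [folklore] -/
theorem norm_kernelA_le_div_cube (α : ℝ) (hT : 0 < T) {T₁ : ℝ} (hT₁ : 0 < T₁) (ht : T₁ < |t|) :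
    ‖kernelA α T t‖ ≤ 4 * T ^ 2 * Real.exp (-1) * Real.exp (-(T₁ ^ 2 / (4 * T ^ 2))) / |t| ^ 3 := by
  have ht0 : 0 < |t| := hT₁.trans ht
  have htne : t ≠ 0 := abs_pos.1 ht0
  rw [norm_kernelA]
  have h1 := norm_inv_add_mul_I_le_abs α htne
  have hexp_split : Real.exp (-(t ^ 2 / (2 * T ^ 2))) =
      Real.exp (-(1 / (4 * T ^ 2) * t ^ 2)) * Real.exp (-(1 / (4 * T ^ 2) * t ^ 2)) := by
    rw [← Real.exp_add]; congr 1; field_simp; ring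
  have h2 : t ^ 2 * Real.exp (-(1 / (4 * T ^ 2) * t ^ 2)) ≤ Real.exp (-1) / (1 / (4 * T ^ 2)) :=
    mul_exp_neg_le (t ^ 2) (by positivity)
  have h3 : Real.exp (-(1 / (4 * T ^ 2) * t ^ 2)) ≤ Real.exp (-(T₁ ^ 2 / (4 * T ^ 2))) := by
    refine Real.exp_le_exp.2 ?_
    have : T₁ ^ 2 ≤ t ^ 2 := by
      rw [← sq_abs t]; exact pow_le_pow_left₀ hT₁.le ht.le 2
    have hT4 : 0 < 4 * T ^ 2 := by positivity
    rw [neg_le_neg_iff, div_le_iff₀ hT4]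
    calc T₁ ^ 2 ≤ t ^ 2 := this
      _ = 1 / (4 * T ^ 2) * t ^ 2 * (4 * T ^ 2) := by field_simp
  rw [le_div_iff₀ (by positivity)]
  have habs3 : |t| ^ 3 = t ^ 2 * |t| := by rw [← sq_abs]; ring
  rw [habs3, hexp_split]
  have he1 : 0 < Real.exp (-(1 / (4 * T ^ 2) * t ^ 2)) := Real.exp_pos _
  calc Real.exp (-(1 / (4 * T ^ 2) * t ^ 2)) * Real.exp (-(1 / (4 * T ^ 2) * t ^ 2)) *
        ‖((α : ℂ) + t * I)⁻¹‖ * (t ^ 2 * |t|)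
      = (t ^ 2 * Real.exp (-(1 / (4 * T ^ 2) * t ^ 2))) * Real.exp (-(1 / (4 * T ^ 2) * t ^ 2)) *
          (‖((α : ℂ) + t * I)⁻¹‖ * |t|) := by ring
    _ ≤ (Real.exp (-1) / (1 / (4 * T ^ 2))) * Real.exp (-(T₁ ^ 2 / (4 * T ^ 2))) * 1 := by
        refine mul_le_mul (mul_le_mul h2 h3 he1.le (by positivity)) ?_ (by positivity) (by positivity)
        have := mul_le_mul_of_nonneg_right h1 ht0.le
        rwa [inv_mul_cancel₀ ht0.ne'] at this
    _ = 4 * T ^ 2 * Real.exp (-1) * Real.exp (-(T₁ ^ 2 / (4 * T ^ 2))) := by field_simp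

/-! ### The Fourier integral of the smoothed Perron formula as a saddle-point integral -/

/-- **`∫ G_T(ξ) x^{2πiξ} ζ(α + 2πiξ, y)/(α + 2πiξ) dξ = (ζ(α, y)/2π) ∫ exp(e(t)) A(t) dt`** (`α, T, x > 0`):
the substitution `t = 2πξ` and `exp(e(t)) = ζ(α + it, y) x^{it}/ζ(α, y)`. [cite: HildebrandTenenbaum1986, §4 (4.2)–(4.3)] -/
theorem integral_perronDamping_eq (hα : 0 < α) (T : ℝ) (hx : 0 < x) (y : ℕ) :
    ∫ ξ : ℝ, GaussPerron.perronDamping T ξ * ((x : ℂ) ^ (2 * Real.pi * ξ * I) *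
        smoothZetaC ((α : ℂ) + 2 * Real.pi * ξ * I) y / ((α : ℂ) + 2 * Real.pi * ξ * I)) =
      (((smoothZeta α y / (2 * Real.pi) : ℝ)) : ℂ) *
        ∫ t : ℝ, SaddleKernel.kernelIntegrand x α y (kernelA α T) t := by
  set f : ℝ → ℂ := SaddleKernel.kernelIntegrand x α y (kernelA α T) with hf
  have hζ0 : 0 < smoothZeta α y := smoothZeta_pos hα
  have hζC : ((smoothZeta α y : ℝ) : ℂ) ≠ 0 := by exact_mod_cast hζ0.ne'
  have hxC : (x : ℂ) ≠ 0 := by exact_mod_cast hx.ne'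
  have hpt : ∀ ξ : ℝ, GaussPerron.perronDamping T ξ * ((x : ℂ) ^ (2 * Real.pi * ξ * I) *
      smoothZetaC ((α : ℂ) + 2 * Real.pi * ξ * I) y / ((α : ℂ) + 2 * Real.pi * ξ * I)) =
        ((smoothZeta α y : ℝ) : ℂ) * f (2 * Real.pi * ξ) := by
    intro ξ
    rw [hf, SaddleKernel.kernelIntegrand, exp_saddleExponent hα x y, kernelA]
    have hG : GaussPerron.perronDamping T ξ =
        ((Real.exp (-((2 * Real.pi * ξ) ^ 2 / (2 * T ^ 2))) : ℝ) : ℂ) := by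
      rw [GaussPerron.perronDamping, Complex.ofReal_exp]
      congr 1; push_cast; ring
    have hX : (x : ℂ) ^ (2 * Real.pi * ξ * I) = Complex.exp ((((2 * Real.pi * ξ) * Real.log x : ℝ)) * I) := by
      rw [Complex.cpow_def_of_ne_zero hxC, ← Complex.ofReal_log hx.le]
      congr 1; push_cast; ring
    rw [hG, hX]
    push_cast
    field_simp
  simp_rw [hpt]
  rw [integral_const_mul, Measure.integral_comp_mul_left f (2 * Real.pi), Complex.real_smul, ← mul_assoc]
  congr 1
  have hπ : 0 < 2 * Real.pi := by positivity
  rw [abs_of_pos (inv_pos.2 hπ)]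
  push_cast
  field_simp

/-! ### The Gaussian mean of `|ζ(α + it, y)|` -/

/-- **The error of the smoothed Perron formula from three-zone bounds.** If `|ζ(α + it, y)| ≤ ζ₀` always,
`≤ ζ₀ e^{-t²φ/100}` for `|t| ≤ π/L` and `≤ ζ₀ ε` for `π/L ≤ |t| ≤ T_d`, then
`∫ e^{-8π²ξ²/T²} |ζ(α + 2πiξ, y)| dξ ≤ (ζ₀/2π)(√(100π/φ) + 2εT_d + e^{-T_d²/T²} √(πT²))`.
[cite: HildebrandTenenbaum1986, §4 Lemma 9 and (4.6)] -/
theorem integral_norm_le (α : ℝ) (hT : 0 < T) {φ ε Td L ζ₀ : ℝ} (hφ : 0 < φ) (hε : 0 ≤ ε) (hTd : 0 < Td)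
    (hζ : 0 ≤ ζ₀) (hall : ∀ t : ℝ, ‖smoothZetaC ((α : ℂ) + t * I) y‖ ≤ ζ₀)
    (hnear : ∀ t : ℝ, |t| ≤ Real.pi / L → ‖smoothZetaC ((α : ℂ) + t * I) y‖ ≤ ζ₀ * Real.exp (-(t ^ 2 * φ / 100)))
    (hmid : ∀ t : ℝ, Real.pi / L ≤ |t| → |t| ≤ Td → ‖smoothZetaC ((α : ℂ) + t * I) y‖ ≤ ζ₀ * ε) :
    ∫ ξ : ℝ, ‖GaussPerron.perronDamping (T / 2) ξ‖ * ‖smoothZetaC ((α : ℂ) + 2 * Real.pi * ξ * I) y‖ ≤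
      1 / (2 * Real.pi) * (ζ₀ * (Real.sqrt (Real.pi / (φ / 100)) + ε * (2 * Td) +
        Real.exp (-(Td ^ 2 / T ^ 2)) * Real.sqrt (Real.pi / (1 / T ^ 2)))) := by
  set h : ℝ → ℝ := fun t => Real.exp (-(2 * t ^ 2 / T ^ 2)) * ‖smoothZetaC ((α : ℂ) + t * I) y‖ with hh
  -- the substitution `t = 2πξ`
  have hpt : ∀ ξ : ℝ, ‖GaussPerron.perronDamping (T / 2) ξ‖ * ‖smoothZetaC ((α : ℂ) + 2 * Real.pi * ξ * I) y‖ =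
      h (2 * Real.pi * ξ) := by
    intro ξ
    simp only [hh, GaussPerron.norm_perronDamping]
    congr 1
    · congr 1; field_simp
    · push_cast; ring_nf
  simp_rw [hpt]
  rw [Measure.integral_comp_mul_left h (2 * Real.pi), smul_eq_mul, abs_of_pos (inv_pos.2 (by positivity)), one_div]
  refine mul_le_mul_of_nonneg_left ?_ (inv_nonneg.2 (by positivity))
  -- the majorant
  set M : ℝ → ℝ := fun t => ζ₀ * (Real.exp (-(φ / 100) * t ^ 2) + ε * (Set.Icc (-Td) Td).indicator 1 t +
    Real.exp (-(Td ^ 2 / T ^ 2)) * Real.exp (-(1 / T ^ 2) * t ^ 2)) with hM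
  have hMint : Integrable M := by
    refine Integrable.const_mul ((Integrable.add ?_ ?_).add ?_) ζ₀
    · exact integrable_exp_neg_mul_sq (by positivity)
    · exact ((integrableOn_const (by simp [Real.volume_Icc])).integrable_indicator measurableSet_Icc).const_mul ε
    · exact (integrable_exp_neg_mul_sq (by positivity)).const_mul _
  have hMval : ∫ t, M t = ζ₀ * (Real.sqrt (Real.pi / (φ / 100)) + ε * (2 * Td) +
      Real.exp (-(Td ^ 2 / T ^ 2)) * Real.sqrt (Real.pi / (1 / T ^ 2))) := by
    simp only [hM]
    rw [integral_const_mul, integral_add, integral_add, integral_gaussian, integral_const_mul, integral_const_mul,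
      integral_gaussian, integral_indicator measurableSet_Icc]
    · have hI : ∫ x in Set.Icc (-Td) Td, (1 : ℝ → ℝ) x = 2 * Td := by
        simp only [Pi.one_apply, setIntegral_const, smul_eq_mul, mul_one]
        rw [Real.volume_real_Icc_of_le (by linarith)]; ring
      rw [hI]
    · exact integrable_exp_neg_mul_sq (by positivity)
    · exact ((integrableOn_const (by simp [Real.volume_Icc])).integrable_indicator measurableSet_Icc).const_mul ε
    · exact (integrable_exp_neg_mul_sq (by positivity)).add
        (((integrableOn_const (by simp [Real.volume_Icc])).integrable_indicator measurableSet_Icc).const_mul ε)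
    · exact (integrable_exp_neg_mul_sq (by positivity)).const_mul _
  rw [← hMval]
  refine integral_mono_of_nonneg (Eventually.of_forall fun t => by positivity) hMint
    (Eventually.of_forall fun t => ?_)
  -- pointwise `h ≤ M`
  simp only [hh, hM]
  have hexp1 : Real.exp (-(2 * t ^ 2 / T ^ 2)) ≤ 1 := Real.exp_le_one_iff.2 (neg_nonpos.2 (by positivity))
  have hg1 : 0 ≤ Real.exp (-(φ / 100) * t ^ 2) := (Real.exp_pos _).le
  have hg2 : 0 ≤ ε * (Set.Icc (-Td) Td).indicator (1 : ℝ → ℝ) t :=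
    mul_nonneg hε (Set.indicator_nonneg (fun _ _ => zero_le_one) t)
  have hg3 : 0 ≤ Real.exp (-(Td ^ 2 / T ^ 2)) * Real.exp (-(1 / T ^ 2) * t ^ 2) := by positivity
  have hn0 : 0 ≤ ‖smoothZetaC ((α : ℂ) + t * I) y‖ := norm_nonneg _
  rcases le_or_gt |t| (Real.pi / L) with ht1 | ht1
  · -- near the axis
    have h1 := hnear t ht1
    calc Real.exp (-(2 * t ^ 2 / T ^ 2)) * ‖smoothZetaC ((α : ℂ) + t * I) y‖
        ≤ 1 * (ζ₀ * Real.exp (-(t ^ 2 * φ / 100))) := mul_le_mul hexp1 h1 hn0 zero_le_one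
      _ = ζ₀ * Real.exp (-(φ / 100) * t ^ 2) := by ring_nf
      _ ≤ _ := by nlinarith [mul_nonneg hζ hg2, mul_nonneg hζ hg3]
  · rcases le_or_gt |t| Td with ht2 | ht2
    · -- the middle zone
      have h1 := hmid t ht1.le ht2
      have hind : (Set.Icc (-Td) Td).indicator (1 : ℝ → ℝ) t = 1 := by
        rw [Set.indicator_of_mem (Set.mem_Icc.2 (abs_le.1 ht2)), Pi.one_apply]
      rw [hind]
      calc Real.exp (-(2 * t ^ 2 / T ^ 2)) * ‖smoothZetaC ((α : ℂ) + t * I) y‖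
          ≤ 1 * (ζ₀ * ε) := mul_le_mul hexp1 h1 hn0 zero_le_one
        _ ≤ _ := by nlinarith [mul_nonneg hζ hg1, mul_nonneg hζ hg3]
    · -- far out: the Gaussian factor
      have h1 := hall t
      have hsq : Td ^ 2 ≤ t ^ 2 := by rw [← sq_abs t]; exact pow_le_pow_left₀ hTd.le ht2.le 2
      have hexp2 : Real.exp (-(2 * t ^ 2 / T ^ 2)) ≤ Real.exp (-(Td ^ 2 / T ^ 2)) * Real.exp (-(1 / T ^ 2) * t ^ 2) := by
        rw [← Real.exp_add]
        refine Real.exp_le_exp.2 ?_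
        have hT2 : 0 < T ^ 2 := by positivity
        rw [show -(2 * t ^ 2 / T ^ 2) = -(t ^ 2 / T ^ 2) + -(t ^ 2 / T ^ 2) by ring,
          show -(1 / T ^ 2) * t ^ 2 = -(t ^ 2 / T ^ 2) by ring]
        have : Td ^ 2 / T ^ 2 ≤ t ^ 2 / T ^ 2 := div_le_div_of_nonneg_right hsq hT2.le
        linarith
      calc Real.exp (-(2 * t ^ 2 / T ^ 2)) * ‖smoothZetaC ((α : ℂ) + t * I) y‖
          ≤ (Real.exp (-(Td ^ 2 / T ^ 2)) * Real.exp (-(1 / T ^ 2) * t ^ 2)) * ζ₀ :=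
            mul_le_mul hexp2 h1 hn0 hg3
        _ ≤ _ := by nlinarith [mul_nonneg hζ hg1, mul_nonneg hζ hg2]

/-! ### The analytic core: smoothed Perron + window + tails -/

/-- `√(2π/φ)/(2πα) = 1/(α√(2πφ))`. [folklore] -/
theorem sqrt_div_div_eq {φ : ℝ} (hφ : 0 < φ) (hα : 0 < α) :
    1 / (2 * Real.pi) * (α⁻¹ * Real.sqrt (2 * Real.pi / φ)) = 1 / (α * Real.sqrt (2 * Real.pi * φ)) := by
  have hπ : 0 < 2 * Real.pi := by positivity
  have h1 : Real.sqrt (2 * Real.pi / φ) = Real.sqrt (2 * Real.pi) / Real.sqrt φ := Real.sqrt_div' _ hφ.le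
  have h2 : Real.sqrt (2 * Real.pi * φ) = Real.sqrt (2 * Real.pi) * Real.sqrt φ := Real.sqrt_mul hπ.le φ
  have hs0 : 0 < Real.sqrt (2 * Real.pi) := Real.sqrt_pos.2 hπ
  have hsφ : 0 < Real.sqrt φ := Real.sqrt_pos.2 hφ
  have hsq : Real.sqrt (2 * Real.pi) ^ 2 = 2 * Real.pi := Real.sq_sqrt hπ.le
  rw [h1, h2]
  field_simp
  nlinarith [hsq]

/-- **The analytic core of the regime-A theorem.** With `α = α(x, y) ∈ [3/5, 1]`, `αlog y ≥ 1`, a Gaussian width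
`T_g ≥ 4`, a window `W/√φ ≤ π/log y ≤ 1` with `Φ₃τ³/6 + Φ₄τ⁴ ≤ 1`, a decay height `T_d ≥ 3` and the decay
`|ζ(α+it, y)| ≤ ε ζ(α, y)` on `π/log y ≤ |t| ≤ T_d`: if `K_w` bounds the window error of
`norm_setIntegral_window_saddle_sub_main_le` for the kernel `A(t) = e^{-t²/2T_g²}/(α+it)` and `K_t` the tail bound of
`SaddleKernel.norm_tailIntegral_le_window`, then
`|x^{-α}Ψ(x,y) - m| ≤ (α²/2T_g²)(m + ζ(α,y)(K_w+K_t)/2π) + ζ(α,y)(K_w+K_t)/2π + (4√(2π)/T_g) J`,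
`m = ζ(α, y)/(α√(2πφ))`, `J` the three-zone bound of `integral_norm_le`.
[cite: HildebrandTenenbaum1986, §4 Lemmas 9–11, (4.2)–(4.8)] -/
theorem abs_rpow_mul_card_sub_main_le {x Tg W Td ε Kw Kt : ℝ} {y : ℕ} (hx : 1 < x) (hy : 2 ≤ y)
    (hα : 3 / 5 ≤ saddlePoint x y) (hα1 : saddlePoint x y ≤ 1) (hαL : 1 ≤ saddlePoint x y * Real.log y)
    (hTg : 4 ≤ Tg) (hW : 0 < W)
    (hτ : W / Real.sqrt (saddlePhi₂ (saddlePoint x y) y) ≤ Real.pi / Real.log y) (hy1 : Real.pi / Real.log y ≤ 1)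
    (hTd : 3 ≤ Td) (hε : 0 ≤ ε)
    (hdec : ∀ t : ℝ, Real.pi / Real.log y ≤ |t| → |t| ≤ Td →
      ‖smoothZetaC ((saddlePoint x y : ℂ) + t * I) y‖ ≤ smoothZeta (saddlePoint x y) y * ε)
    (hsmall : saddlePhi₃ (saddlePoint x y) y / 6 * (W / Real.sqrt (saddlePhi₂ (saddlePoint x y) y)) ^ 3 +
      saddlePhi₄ (saddlePoint x y) y * (W / Real.sqrt (saddlePhi₂ (saddlePoint x y) y)) ^ 4 ≤ 1)
    (hKw : ‖((saddlePoint x y : ℝ) : ℂ)⁻¹‖ *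
          (Real.exp (-(saddlePhi₂ (saddlePoint x y) y / 4) * (W / Real.sqrt (saddlePhi₂ (saddlePoint x y) y)) ^ 2) *
            Real.sqrt (4 * Real.pi / saddlePhi₂ (saddlePoint x y) y)) +
        Real.sqrt (4 * Real.pi / saddlePhi₂ (saddlePoint x y) y) *
          (Real.exp 1 * (1 / saddlePoint x y ^ 3 + 1 / (2 * Tg ^ 2 * saddlePoint x y)) *
              (4 * 1 / (Real.exp 1 * saddlePhi₂ (saddlePoint x y) y)) ^ 1 +
            (‖((saddlePoint x y : ℝ) : ℂ)⁻¹‖ * saddlePhi₄ (saddlePoint x y) y +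
                ‖-I / ((saddlePoint x y : ℝ) : ℂ) ^ 2‖ *
                  (saddlePhi₃ (saddlePoint x y) y / 3 + saddlePhi₄ (saddlePoint x y) y)) *
              (4 * 2 / (Real.exp 1 * saddlePhi₂ (saddlePoint x y) y)) ^ 2 +
            (‖((saddlePoint x y : ℝ) : ℂ)⁻¹‖ * saddlePhi₃ (saddlePoint x y) y ^ 2 / 18 +
                ‖-I / ((saddlePoint x y : ℝ) : ℂ) ^ 2‖ * saddlePhi₄ (saddlePoint x y) y) *
              (4 * 3 / (Real.exp 1 * saddlePhi₂ (saddlePoint x y) y)) ^ 3 +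
            2 * ‖((saddlePoint x y : ℝ) : ℂ)⁻¹‖ * saddlePhi₄ (saddlePoint x y) y ^ 2 *
              (4 * 4 / (Real.exp 1 * saddlePhi₂ (saddlePoint x y) y)) ^ 4) ≤ Kw)
    (hKt : 1 / saddlePoint x y * Real.exp (-(W ^ 2 / 140)) *
          Real.sqrt (125 * Real.pi ^ 3 / saddlePhi₂ (saddlePoint x y) y) +
        10 * Real.pi * ε * (1 / saddlePoint x y) / saddlePoint x y + 2 * Real.pi * ε * (1 / saddlePoint x y) * Td +
        2 * Real.pi * (4 * Tg ^ 2 * Real.exp (-1) * Real.exp (-(Td ^ 2 / (4 * Tg ^ 2)))) / Td ^ 2 ≤ Kt) :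
    |x ^ (-saddlePoint x y) * ((Nat.smoothNumbersUpTo ⌊x⌋₊ (y + 1)).card : ℝ) -
        smoothZeta (saddlePoint x y) y /
          (saddlePoint x y * Real.sqrt (2 * Real.pi * saddlePhi₂ (saddlePoint x y) y))| ≤
      saddlePoint x y ^ 2 / (2 * Tg ^ 2) *
          (smoothZeta (saddlePoint x y) y /
              (saddlePoint x y * Real.sqrt (2 * Real.pi * saddlePhi₂ (saddlePoint x y) y)) +
            smoothZeta (saddlePoint x y) y / (2 * Real.pi) * (Kw + Kt)) +
        smoothZeta (saddlePoint x y) y / (2 * Real.pi) * (Kw + Kt) +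
        4 * Real.sqrt (2 * Real.pi) / Tg * (1 / (2 * Real.pi) * (smoothZeta (saddlePoint x y) y *
          (Real.sqrt (Real.pi / (saddlePhi₂ (saddlePoint x y) y / 100)) + ε * (2 * Td) +
            Real.exp (-(Td ^ 2 / Tg ^ 2)) * Real.sqrt (Real.pi / (1 / Tg ^ 2))))) := by
  set α : ℝ := saddlePoint x y with hαdef
  have hα0 : 0 < α := by linarith
  have hx0 : 0 < x := by linarith
  set φ : ℝ := saddlePhi₂ α y with hφdef
  have hφ0 : 0 < φ := saddlePhi₂_pos hy hα0
  set ζ₀ : ℝ := smoothZeta α y with hζ₀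
  have hζ0 : 0 < ζ₀ := smoothZeta_pos hα0
  set L : ℝ := Real.log y with hL
  have hL0 : 0 < L := Real.log_pos (by exact_mod_cast lt_of_lt_of_le one_lt_two hy)
  have hTg0 : 0 < Tg := by linarith
  have hTd0 : 0 < Td := by linarith
  have hαTg : α ≤ Tg / 2 := by linarith
  set τ : ℝ := W / Real.sqrt φ with hτdef
  have hτ0 : 0 < τ := div_pos hW (Real.sqrt_pos.2 hφ0)
  set A : ℝ → ℂ := kernelA α Tg with hA
  have hAc : Continuous A := continuous_kernelA hα0 Tg
  have hAi : Integrable A := integrable_kernelA hα0 hTg0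
  set f : ℝ → ℂ := SaddleKernel.kernelIntegrand x α y A with hf
  have hfi : Integrable f := SaddleKernel.integrable_kernelIntegrand hα0 x y hAc hAi
  -- (1) the smoothed Perron formula
  have hF3 := GaussPerron.card_smooth_gaussPerron_integral hx.le hα0 hTg0 hαTg y
  have hI := integral_perronDamping_eq hα0 Tg hx0 y
  rw [hI] at hF3
  -- (2) the Gaussian mean of `|ζ|`
  have hJ := integral_norm_le (y := y) α hTg0 (L := L) hφ0 hε hTd0 hζ0.le (fun t => norm_smoothZetaC_le hα0 t y)
    (fun t ht => norm_smoothZetaC_le_mul_exp_neg_of_one_le_mul_log hα0 hy hαL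
      (by rwa [le_div_iff₀ hL0] at ht))
    (fun t ht1 ht2 => hdec t ht1 ht2)
  -- (3) the window
  have hB₂0 : 0 ≤ 1 / α ^ 3 + 1 / (2 * Tg ^ 2 * α) := by positivity
  have hwin := norm_setIntegral_window_saddle_sub_main_le (A := A) (A₀ := ((α : ℝ) : ℂ)⁻¹) (A₁ := -I / ((α : ℝ) : ℂ) ^ 2)
    (B₂ := 1 / α ^ 3 + 1 / (2 * Tg ^ 2 * α)) (τ := τ) hx hy hτ0.le hB₂0 hAc
    (fun t _ => norm_kernelA_sub_taylor_le hα0 hTg0 t) hsmall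
  -- (4) the tails
  have hB₃0 : 0 ≤ 4 * Tg ^ 2 * Real.exp (-1) * Real.exp (-(Td ^ 2 / (4 * Tg ^ 2))) := by positivity
  have htail := SaddleKernel.norm_tailIntegral_le_window (x := x) (y := y) (T := Td) (ε₁ := ε) (ε₂ := ε)
    (B₀ := 1 / α) (Ba := 1 / α) (B₃ := 4 * Tg ^ 2 * Real.exp (-1) * Real.exp (-(Td ^ 2 / (4 * Tg ^ 2)))) (W := W)
    (A := A) hy hα hα1 hφ0 hW hτ hy1 hTd hε hε
    (fun t ht1 ht2 => by
      rw [div_le_iff₀ hζ0]; have := hdec t ht1 (ht2.trans hTd); linarith)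
    (fun t ht1 ht2 => by
      rw [div_le_iff₀ hζ0]; have := hdec t (hy1.trans ((show (1 : ℝ) ≤ 3 by norm_num).trans ht1)) ht2; linarith)
    hAc hAi (by positivity) (by positivity) hB₃0 (fun t _ => norm_kernelA_le hα0 Tg t)
    (fun t => norm_kernelA_le hα0 Tg t) (fun t ht => norm_kernelA_le_div_cube α hTg0 hTd0 ht)
  -- (5) `K = ∫_{window} + ∫_{tails}` and `‖K - α⁻¹ √(2π/φ)‖ ≤ K_w + K_t`
  set K : ℂ := ∫ t, f t with hK
  have hsplit : (∫ t in Set.Icc (-τ) τ, f t) + ∫ t in (Set.Icc (-τ) τ)ᶜ, f t = K :=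
    integral_add_compl measurableSet_Icc hfi
  set main : ℂ := ((α : ℝ) : ℂ)⁻¹ * ((Real.sqrt (2 * Real.pi / φ) : ℝ) : ℂ) with hmain
  have hKmain : ‖K - main‖ ≤ Kw + Kt := by
    have h1 : K - main = ((∫ t in Set.Icc (-τ) τ, f t) - main) + ∫ t in (Set.Icc (-τ) τ)ᶜ, f t := by
      rw [← hsplit]; ring
    rw [h1]
    exact (norm_add_le _ _).trans (add_le_add (hwin.trans hKw) (htail.trans hKt))
  -- (6) real parts
  have hmain_re : main.re = α⁻¹ * Real.sqrt (2 * Real.pi / φ) := by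
    rw [hmain, ← Complex.ofReal_inv, ← Complex.ofReal_mul, Complex.ofReal_re]
  have hIre : ((((ζ₀ / (2 * Real.pi) : ℝ)) : ℂ) * K).re = ζ₀ / (2 * Real.pi) * K.re := Complex.re_ofReal_mul _ _
  set δ : ℝ := ζ₀ / (2 * Real.pi) * (K - main).re with hδ
  have hKre : ζ₀ / (2 * Real.pi) * K.re = ζ₀ / (α * Real.sqrt (2 * Real.pi * φ)) + δ := by
    have : K.re = main.re + (K - main).re := by simp
    rw [this, hmain_re, mul_add, hδ]
    congr 1
    rw [show ζ₀ / (2 * Real.pi) * (α⁻¹ * Real.sqrt (2 * Real.pi / φ)) =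
      ζ₀ * (1 / (2 * Real.pi) * (α⁻¹ * Real.sqrt (2 * Real.pi / φ))) by ring, sqrt_div_div_eq hφ0 hα0]
    ring
  have hδle : |δ| ≤ ζ₀ / (2 * Real.pi) * (Kw + Kt) := by
    rw [hδ, abs_mul, abs_of_pos (by positivity : 0 < ζ₀ / (2 * Real.pi))]
    exact mul_le_mul_of_nonneg_left ((Complex.abs_re_le_norm _).trans hKmain) (by positivity)
  -- (7) assemble
  set m : ℝ := ζ₀ / (α * Real.sqrt (2 * Real.pi * φ)) with hm
  have hm0 : 0 ≤ m := by positivity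
  set s : ℝ := α ^ 2 / (2 * Tg ^ 2) with hs
  set P : ℝ := x ^ (-α) * ((Nat.smoothNumbersUpTo ⌊x⌋₊ (y + 1)).card : ℝ) with hP
  set Δ : ℝ := ζ₀ / (2 * Real.pi) * (Kw + Kt) with hΔ
  rw [hIre, hKre] at hF3
  have hR := le_trans hF3 (mul_le_mul_of_nonneg_left hJ (by positivity))
  -- `P - m = (P - e^{-s}(m + δ)) + (e^{-s} - 1)(m + δ) + δ`
  have he1 : Real.exp (-s) ≤ 1 := Real.exp_le_one_iff.2 (neg_nonpos.2 (by positivity))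
  have he2 : 1 - Real.exp (-s) ≤ s := LFunctions.PrimeReciprocal.one_sub_exp_neg_le s
  have hkey : P - m = (P - Real.exp (-s) * (m + δ)) + (Real.exp (-s) - 1) * (m + δ) + δ := by ring
  rw [hkey]
  have hA1 : |P - Real.exp (-s) * (m + δ) + (Real.exp (-s) - 1) * (m + δ) + δ| ≤
      |P - Real.exp (-s) * (m + δ)| + |(Real.exp (-s) - 1) * (m + δ)| + |δ| := by
    refine (abs_add_le _ _).trans ?_
    linarith [abs_add_le (P - Real.exp (-s) * (m + δ)) ((Real.exp (-s) - 1) * (m + δ))]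
  have h2 : |(Real.exp (-s) - 1) * (m + δ)| ≤ s * (m + Δ) := by
    rw [abs_mul, show |Real.exp (-s) - 1| = 1 - Real.exp (-s) by rw [abs_sub_comm]; exact abs_of_nonneg (by linarith)]
    refine mul_le_mul he2 ((abs_add_le _ _).trans ?_) (abs_nonneg _) (by positivity)
    rw [abs_of_nonneg hm0]; linarith
  have h3 : |δ| ≤ Δ := hδle
  linarith [hA1, hR, h2, h3]

/-! ### Book-keeping: the window, tail and mean bounds are `O(1/(α√φ u))` -/

/-- `e ≥ 2.7`-type numerics: `(8/(eφ))² ≤ 9/φ²`, `(12/(eφ))³ ≤ 88/φ³`, `(16/(eφ))⁴ ≤ 1234/φ⁴`. [folklore] -/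
theorem exp_one_pow_bounds {φ : ℝ} (hφ : 0 < φ) :
    (4 * 2 / (Real.exp 1 * φ)) ^ 2 ≤ 9 / φ ^ 2 ∧ (4 * 3 / (Real.exp 1 * φ)) ^ 3 ≤ 88 / φ ^ 3 ∧
      (4 * 4 / (Real.exp 1 * φ)) ^ 4 ≤ 1234 / φ ^ 4 := by
  set E : ℝ := Real.exp 1 with hE
  have he : 2.7182818283 < E := Real.exp_one_gt_d9
  have he0 : 0 < E := by linarith
  have he2 : (7.389 : ℝ) < E ^ 2 := by nlinarith
  have he3 : (20.08 : ℝ) < E ^ 3 := by nlinarith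
  have he4 : (54.5 : ℝ) < E ^ 4 := by nlinarith
  have hφ2 := pow_pos hφ 2
  have hφ3 := pow_pos hφ 3
  have hφ4 := pow_pos hφ 4
  refine ⟨?_, ?_, ?_⟩
  · calc (4 * 2 / (E * φ)) ^ 2 = 64 / (E ^ 2 * φ ^ 2) := by rw [div_pow]; ring
      _ ≤ 9 / φ ^ 2 := by
          rw [div_le_div_iff₀ (by positivity) (by positivity)]
          nlinarith [mul_le_mul_of_nonneg_right he2.le hφ2.le]
  · calc (4 * 3 / (E * φ)) ^ 3 = 1728 / (E ^ 3 * φ ^ 3) := by rw [div_pow]; ring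
      _ ≤ 88 / φ ^ 3 := by
          rw [div_le_div_iff₀ (by positivity) (by positivity)]
          nlinarith [mul_le_mul_of_nonneg_right he3.le hφ3.le]
  · calc (4 * 4 / (E * φ)) ^ 4 = 65536 / (E ^ 4 * φ ^ 4) := by rw [div_pow]; ring
      _ ≤ 1234 / φ ^ 4 := by
          rw [div_le_div_iff₀ (by positivity) (by positivity)]
          nlinarith [mul_le_mul_of_nonneg_right he4.le hφ4.le]

/-- `√(4π/φ) ≤ 4/√φ` and `√(125π³/φ) ≤ 63/√φ`. [folklore] -/
theorem sqrt_pi_div_bounds {φ : ℝ} (hφ : 0 < φ) :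
    Real.sqrt (4 * Real.pi / φ) ≤ 4 / Real.sqrt φ ∧ Real.sqrt (125 * Real.pi ^ 3 / φ) ≤ 63 / Real.sqrt φ := by
  have hπ := Real.pi_lt_d2
  have hπ3 : Real.pi ^ 3 < 3.15 ^ 3 := pow_lt_pow_left₀ hπ Real.pi_pos.le (by norm_num)
  have hs : 0 < Real.sqrt φ := Real.sqrt_pos.2 hφ
  constructor
  · rw [Real.sqrt_div' _ hφ.le, div_le_div_iff_of_pos_right hs]
    calc Real.sqrt (4 * Real.pi) ≤ Real.sqrt (4 ^ 2) := Real.sqrt_le_sqrt (by nlinarith [Real.pi_pos])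
      _ = 4 := Real.sqrt_sq (by norm_num)
  · rw [Real.sqrt_div' _ hφ.le, div_le_div_iff_of_pos_right hs]
    calc Real.sqrt (125 * Real.pi ^ 3) ≤ Real.sqrt (63 ^ 2) := Real.sqrt_le_sqrt (by nlinarith)
      _ = 63 := Real.sqrt_sq (by norm_num)

set_option maxHeartbeats 1600000 in
/-- **The window error is `O(1/(α√φ u))`.** [cite: HildebrandTenenbaum1986, §4 (4.7)–(4.8)] -/
theorem window_bound_le {α φ L u ℓ P3 P4 cφ Tg W : ℝ} (hα : 3 / 5 ≤ α) (hα1 : α ≤ 1) (hφ : 0 < φ) (hcφ : 0 < cφ)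
    (hφlo : cφ * u * L ^ 2 ≤ φ) (hL : 1 ≤ L) (hu : 16 ≤ u) (hexpℓ : Real.exp (-(35 * ℓ)) ≤ 1 / u) (hℓ : 0 ≤ ℓ)
    (hP3 : 0 ≤ P3) (hP4 : 0 ≤ P4) (hP3le : P3 ≤ 5 * L * φ) (hP4le : P4 ≤ 37 * L ^ 2 * φ)
    (hTg : Tg = u / 4) (hW : W = Real.sqrt (140 * ℓ)) :
    ‖((α : ℝ) : ℂ)⁻¹‖ * (Real.exp (-(φ / 4) * (W / Real.sqrt φ) ^ 2) * Real.sqrt (4 * Real.pi / φ)) +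
        Real.sqrt (4 * Real.pi / φ) *
          (Real.exp 1 * (1 / α ^ 3 + 1 / (2 * Tg ^ 2 * α)) * (4 * 1 / (Real.exp 1 * φ)) ^ 1 +
            (‖((α : ℝ) : ℂ)⁻¹‖ * P4 + ‖-I / ((α : ℝ) : ℂ) ^ 2‖ * (P3 / 3 + P4)) * (4 * 2 / (Real.exp 1 * φ)) ^ 2 +
            (‖((α : ℝ) : ℂ)⁻¹‖ * P3 ^ 2 / 18 + ‖-I / ((α : ℝ) : ℂ) ^ 2‖ * P4) * (4 * 3 / (Real.exp 1 * φ)) ^ 3 +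
            2 * ‖((α : ℝ) : ℂ)⁻¹‖ * P4 ^ 2 * (4 * 4 / (Real.exp 1 * φ)) ^ 4) ≤
      (4 + 5500 / cφ + 860000 / cφ ^ 2) * (1 / (α * Real.sqrt φ * u)) := by
  have hα0 : 0 < α := by linarith
  have hu0 : 0 < u := by linarith
  have hL0 : 0 < L := by linarith
  set sφ : ℝ := Real.sqrt φ with hsφ
  have hs0 : 0 < sφ := Real.sqrt_pos.2 hφ
  have hssq : sφ ^ 2 = φ := Real.sq_sqrt hφ.le
  have hn1 : ‖((α : ℝ) : ℂ)⁻¹‖ = 1 / α := by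
    rw [norm_inv, Complex.norm_real, Real.norm_of_nonneg hα0.le, one_div]
  have hn2 : ‖-I / ((α : ℝ) : ℂ) ^ 2‖ = 1 / α ^ 2 := by
    rw [norm_div, norm_neg, Complex.norm_I, norm_pow, Complex.norm_real, Real.norm_of_nonneg hα0.le]
  obtain ⟨hR, -⟩ := sqrt_pi_div_bounds hφ
  obtain ⟨h8, h12, h16⟩ := exp_one_pow_bounds hφ
  have hR0 : 0 ≤ Real.sqrt (4 * Real.pi / φ) := Real.sqrt_nonneg _
  have hφlo1 : cφ * u ≤ φ :=
    le_trans (le_mul_of_one_le_right (by positivity) (one_le_pow₀ hL)) hφlo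
  have hν : 0 < 1 / (α * sφ * u) := by positivity
  -- the Gaussian factor of the window
  have hτsq : (W / sφ) ^ 2 = 140 * ℓ / φ := by rw [hW, div_pow, Real.sq_sqrt (by positivity), hssq]
  have hexpτ : Real.exp (-(φ / 4) * (W / sφ) ^ 2) ≤ 1 / u := by
    rw [hτsq, show -(φ / 4) * (140 * ℓ / φ) = -(35 * ℓ) by field_simp; ring]; exact hexpℓ
  -- term 1
  have hw1 : ‖((α : ℝ) : ℂ)⁻¹‖ * (Real.exp (-(φ / 4) * (W / sφ) ^ 2) * Real.sqrt (4 * Real.pi / φ)) ≤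
      4 * (1 / (α * sφ * u)) := by
    rw [hn1]
    calc 1 / α * (Real.exp (-(φ / 4) * (W / sφ) ^ 2) * Real.sqrt (4 * Real.pi / φ))
        ≤ 1 / α * (1 / u * (4 / sφ)) := by gcongr
      _ = 4 * (1 / (α * sφ * u)) := by field_simp
  -- term 2: `B₂ ≤ 2/α³`
  have hB₂ : 1 / α ^ 3 + 1 / (2 * Tg ^ 2 * α) ≤ 2 / α ^ 3 := by
    rw [hTg]
    have h1 : 1 / (2 * (u / 4) ^ 2 * α) ≤ 1 / α ^ 3 := by
      apply one_div_le_one_div_of_le (by positivity)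
      have : α ^ 3 ≤ 1 := pow_le_one₀ hα0.le hα1
      nlinarith
    have : 1 / α ^ 3 + 1 / α ^ 3 = 2 / α ^ 3 := by ring
    linarith
  have hw2 : Real.sqrt (4 * Real.pi / φ) * (Real.exp 1 * (1 / α ^ 3 + 1 / (2 * Tg ^ 2 * α)) *
      (4 * 1 / (Real.exp 1 * φ)) ^ 1) ≤ 90 / cφ * (1 / (α * sφ * u)) := by
    have he0 : 0 < Real.exp 1 := Real.exp_pos 1
    have heq : Real.exp 1 * (1 / α ^ 3 + 1 / (2 * Tg ^ 2 * α)) * (4 * 1 / (Real.exp 1 * φ)) ^ 1 =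
        4 * (1 / α ^ 3 + 1 / (2 * Tg ^ 2 * α)) / φ := by
      field_simp
    rw [heq]
    calc Real.sqrt (4 * Real.pi / φ) * (4 * (1 / α ^ 3 + 1 / (2 * Tg ^ 2 * α)) / φ)
        ≤ 4 / sφ * (4 * (2 / α ^ 3) / φ) := by gcongr
      _ = 32 / (α ^ 2 * φ) * (1 / (α * sφ)) := by field_simp; ring
      _ ≤ 90 / (cφ * u) * (1 / (α * sφ)) := by
          refine mul_le_mul_of_nonneg_right ?_ (by positivity)
          rw [div_le_div_iff₀ (by positivity) (by positivity)]
          have : 9 / 25 ≤ α ^ 2 := by nlinarith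
          have := mul_le_mul this hφlo1 (by positivity) (sq_nonneg α)
          have hcu : 0 < cφ * u := mul_pos hcφ hu0
          linarith
      _ = 90 / cφ * (1 / (α * sφ * u)) := by field_simp
  -- term 3
  have hbr3 : ‖((α : ℝ) : ℂ)⁻¹‖ * P4 + ‖-I / ((α : ℝ) : ℂ) ^ 2‖ * (P3 / 3 + P4) ≤ 76 / α ^ 2 * (L ^ 2 * φ) := by
    rw [hn1, hn2]
    have ha : 1 / α ≤ 1 / α ^ 2 := by
      apply one_div_le_one_div_of_le (by positivity); nlinarith
    have hLL : L ≤ L ^ 2 := by nlinarith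
    have hP3' : P3 ≤ 5 * L ^ 2 * φ := hP3le.trans (by nlinarith [hφ.le])
    calc 1 / α * P4 + 1 / α ^ 2 * (P3 / 3 + P4) ≤ 1 / α ^ 2 * P4 + 1 / α ^ 2 * (P3 / 3 + P4) := by
          gcongr
      _ = 1 / α ^ 2 * (P3 / 3 + 2 * P4) := by ring
      _ ≤ 1 / α ^ 2 * (5 * L ^ 2 * φ / 3 + 2 * (37 * L ^ 2 * φ)) := by gcongr
      _ ≤ 1 / α ^ 2 * (76 * (L ^ 2 * φ)) := by gcongr; nlinarith [mul_pos (pow_pos hL0 2) hφ]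
      _ = 76 / α ^ 2 * (L ^ 2 * φ) := by ring
  have hw3 : Real.sqrt (4 * Real.pi / φ) *
      ((‖((α : ℝ) : ℂ)⁻¹‖ * P4 + ‖-I / ((α : ℝ) : ℂ) ^ 2‖ * (P3 / 3 + P4)) * (4 * 2 / (Real.exp 1 * φ)) ^ 2) ≤
        4560 / cφ * (1 / (α * sφ * u)) := by
    have hb0 : 0 ≤ ‖((α : ℝ) : ℂ)⁻¹‖ * P4 + ‖-I / ((α : ℝ) : ℂ) ^ 2‖ * (P3 / 3 + P4) := by positivity
    calc Real.sqrt (4 * Real.pi / φ) *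
          ((‖((α : ℝ) : ℂ)⁻¹‖ * P4 + ‖-I / ((α : ℝ) : ℂ) ^ 2‖ * (P3 / 3 + P4)) * (4 * 2 / (Real.exp 1 * φ)) ^ 2)
        ≤ 4 / sφ * (76 / α ^ 2 * (L ^ 2 * φ) * (9 / φ ^ 2)) := by gcongr
      _ = 2736 * L ^ 2 / (α * φ) * (1 / (α * sφ)) := by field_simp; ring
      _ ≤ 4560 / (cφ * u) * (1 / (α * sφ)) := by
          refine mul_le_mul_of_nonneg_right ?_ (by positivity)
          rw [div_le_div_iff₀ (by positivity) (by positivity)]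
          -- `2736 L² cφ u ≤ 4560 α φ`, from `α ≥ 3/5`, `φ ≥ cφ u L²`
          have := mul_le_mul hα hφlo (by positivity) hα0.le
          have h0 : 0 ≤ L ^ 2 * (cφ * u) := by positivity
          have key : 3 / 5 * (L ^ 2 * (cφ * u)) ≤ α * φ := by
            calc 3 / 5 * (L ^ 2 * (cφ * u)) = 3 / 5 * (cφ * u * L ^ 2) := by ring
              _ ≤ α * φ := this
          linarith
      _ = 4560 / cφ * (1 / (α * sφ * u)) := by field_simp
  -- term 4
  have hbr4 : ‖((α : ℝ) : ℂ)⁻¹‖ * P3 ^ 2 / 18 + ‖-I / ((α : ℝ) : ℂ) ^ 2‖ * P4 ≤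
      1 / α ^ 2 * (25 * L ^ 2 * φ ^ 2 / 18 + 37 * L ^ 2 * φ) := by
    rw [hn1, hn2]
    have ha : 1 / α ≤ 1 / α ^ 2 := by
      apply one_div_le_one_div_of_le (by positivity); nlinarith
    have hP3sq : P3 ^ 2 ≤ 25 * L ^ 2 * φ ^ 2 := by nlinarith
    calc 1 / α * P3 ^ 2 / 18 + 1 / α ^ 2 * P4 ≤ 1 / α ^ 2 * (25 * L ^ 2 * φ ^ 2) / 18 + 1 / α ^ 2 * (37 * L ^ 2 * φ) := by
          gcongr
      _ = 1 / α ^ 2 * (25 * L ^ 2 * φ ^ 2 / 18 + 37 * L ^ 2 * φ) := by ring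
  have hw4 : Real.sqrt (4 * Real.pi / φ) *
      ((‖((α : ℝ) : ℂ)⁻¹‖ * P3 ^ 2 / 18 + ‖-I / ((α : ℝ) : ℂ) ^ 2‖ * P4) * (4 * 3 / (Real.exp 1 * φ)) ^ 3) ≤
        (820 / cφ + 1400 / cφ ^ 2) * (1 / (α * sφ * u)) := by
    have hb0 : 0 ≤ ‖((α : ℝ) : ℂ)⁻¹‖ * P3 ^ 2 / 18 + ‖-I / ((α : ℝ) : ℂ) ^ 2‖ * P4 := by positivity
    calc Real.sqrt (4 * Real.pi / φ) *
          ((‖((α : ℝ) : ℂ)⁻¹‖ * P3 ^ 2 / 18 + ‖-I / ((α : ℝ) : ℂ) ^ 2‖ * P4) * (4 * 3 / (Real.exp 1 * φ)) ^ 3)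
        ≤ 4 / sφ * (1 / α ^ 2 * (25 * L ^ 2 * φ ^ 2 / 18 + 37 * L ^ 2 * φ) * (88 / φ ^ 3)) := by gcongr
      _ = (4400 / 9 * L ^ 2 / (α * φ) + 13024 * L ^ 2 / (α * φ ^ 2)) * (1 / (α * sφ)) := by field_simp; ring
      _ ≤ (820 / (cφ * u) + 1400 / (cφ ^ 2 * u)) * (1 / (α * sφ)) := by
          refine mul_le_mul_of_nonneg_right (add_le_add ?_ ?_) (by positivity)
          · rw [div_le_div_iff₀ (by positivity) (by positivity)]
            have := mul_le_mul hα hφlo (by positivity) hα0.le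
            have h0 : 0 ≤ L ^ 2 * (cφ * u) := by positivity
            have key : 3 / 5 * (L ^ 2 * (cφ * u)) ≤ α * φ := by
              calc 3 / 5 * (L ^ 2 * (cφ * u)) = 3 / 5 * (cφ * u * L ^ 2) := by ring
                _ ≤ α * φ := this
            linarith
          · rw [div_le_div_iff₀ (by positivity) (by positivity)]
            -- `13024 L² cφ² u ≤ 1400 α φ²`; `φ² ≥ cφ² u² L⁴`, `u ≥ 16`, `L ≥ 1`, `α ≥ 3/5`
            have hφ2 : cφ ^ 2 * u ^ 2 * L ^ 4 ≤ φ ^ 2 := by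
              calc cφ ^ 2 * u ^ 2 * L ^ 4 = (cφ * u * L ^ 2) ^ 2 := by ring
                _ ≤ φ ^ 2 := pow_le_pow_left₀ (by positivity) hφlo 2
            have hL2 : 1 ≤ L ^ 2 := one_le_pow₀ hL
            have hc0 : 0 ≤ cφ ^ 2 * u * L ^ 2 := by positivity
            have k0 : (13024 : ℝ) ≤ 840 * (u * L ^ 2) := by nlinarith
            have k1 : 13024 * L ^ 2 * (cφ ^ 2 * u) ≤ 840 * (cφ ^ 2 * u ^ 2 * L ^ 4) := by
              have := mul_le_mul_of_nonneg_right k0 hc0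
              nlinarith
            have k2 : 840 * (cφ ^ 2 * u ^ 2 * L ^ 4) ≤ 1400 * (α * φ ^ 2) := by
              have := mul_le_mul hα hφ2 (by positivity) hα0.le
              linarith
            linarith
      _ = (820 / cφ + 1400 / cφ ^ 2) * (1 / (α * sφ * u)) := by field_simp
  -- term 5
  have hw5 : Real.sqrt (4 * Real.pi / φ) * (2 * ‖((α : ℝ) : ℂ)⁻¹‖ * P4 ^ 2 * (4 * 4 / (Real.exp 1 * φ)) ^ 4) ≤
      850000 / cφ ^ 2 * (1 / (α * sφ * u)) := by
    rw [hn1]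
    have hP4sq : P4 ^ 2 ≤ 1369 * L ^ 4 * φ ^ 2 := by nlinarith
    have hc16 : 0 ≤ (4 * 4 / (Real.exp 1 * φ)) ^ 4 := by positivity
    calc Real.sqrt (4 * Real.pi / φ) * (2 * (1 / α) * P4 ^ 2 * (4 * 4 / (Real.exp 1 * φ)) ^ 4)
        ≤ 4 / sφ * (2 * (1 / α) * (1369 * L ^ 4 * φ ^ 2) * (1234 / φ ^ 4)) := by
          refine mul_le_mul hR (mul_le_mul (mul_le_mul_of_nonneg_left hP4sq (by positivity)) h16 hc16
            (by positivity)) (by positivity) (by positivity)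
      _ = 13514768 * L ^ 4 / φ ^ 2 * (1 / (α * sφ)) := by field_simp; ring
      _ ≤ 850000 / (cφ ^ 2 * u) * (1 / (α * sφ)) := by
          refine mul_le_mul_of_nonneg_right ?_ (by positivity)
          rw [div_le_div_iff₀ (by positivity) (by positivity)]
          -- `13514768 L⁴ (cφ² u) ≤ 850000 φ²`, from `φ² ≥ cφ² u² L⁴` and `u ≥ 16`
          have hφ2 : cφ ^ 2 * u ^ 2 * L ^ 4 ≤ φ ^ 2 := by
            calc cφ ^ 2 * u ^ 2 * L ^ 4 = (cφ * u * L ^ 2) ^ 2 := by ring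
              _ ≤ φ ^ 2 := pow_le_pow_left₀ (by positivity) hφlo 2
          have hc0 : 0 ≤ cφ ^ 2 * u * L ^ 4 := by positivity
          have k0 : (13514768 : ℝ) ≤ 850000 * u := by linarith
          have k1 : 13514768 * L ^ 4 * (cφ ^ 2 * u) ≤ 850000 * (cφ ^ 2 * u ^ 2 * L ^ 4) := by
            have := mul_le_mul_of_nonneg_right k0 hc0
            nlinarith
          have k2 : 850000 * (cφ ^ 2 * u ^ 2 * L ^ 4) ≤ 850000 * φ ^ 2 := by linarith
          linarith
      _ = 850000 / cφ ^ 2 * (1 / (α * sφ * u)) := by field_simp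
  have hsum : 4 * (1 / (α * sφ * u)) + (90 / cφ * (1 / (α * sφ * u)) + 4560 / cφ * (1 / (α * sφ * u)) +
      (820 / cφ + 1400 / cφ ^ 2) * (1 / (α * sφ * u)) + 850000 / cφ ^ 2 * (1 / (α * sφ * u))) ≤
        (4 + 5500 / cφ + 860000 / cφ ^ 2) * (1 / (α * sφ * u)) := by
    rw [show 4 * (1 / (α * sφ * u)) + (90 / cφ * (1 / (α * sφ * u)) + 4560 / cφ * (1 / (α * sφ * u)) +
      (820 / cφ + 1400 / cφ ^ 2) * (1 / (α * sφ * u)) + 850000 / cφ ^ 2 * (1 / (α * sφ * u))) =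
        (4 + 5470 / cφ + 851400 / cφ ^ 2) * (1 / (α * sφ * u)) by ring]
    refine mul_le_mul_of_nonneg_right (add_le_add (add_le_add le_rfl ?_) ?_) hν.le
    · exact div_le_div_of_nonneg_right (by norm_num) hcφ.le
    · exact div_le_div_of_nonneg_right (by norm_num) (sq_nonneg _)
  refine le_trans ?_ hsum
  rw [mul_add, mul_add, mul_add]
  linarith [hw1, hw2, hw3, hw4, hw5]

/-- Square roots: `2.5 ≤ √(2π) ≤ 2.6`, `√π ≤ 1.78`, `√(100π) ≤ 18`, `√3 ≤ 1.74`, `√7 ≤ 2.65`. [folklore] -/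
theorem sqrt_consts :
    2.5 ≤ Real.sqrt (2 * Real.pi) ∧ Real.sqrt (2 * Real.pi) ≤ 2.6 ∧ Real.sqrt Real.pi ≤ 1.78 ∧
      Real.sqrt (100 * Real.pi) ≤ 18 ∧ Real.sqrt 3 ≤ 1.74 ∧ Real.sqrt 7 ≤ 2.65 := by
  have hπ := Real.pi_lt_d2
  have hπ' := Real.pi_gt_d2
  refine ⟨?_, ?_, ?_, ?_, ?_, ?_⟩
  · rw [show (2.5 : ℝ) = Real.sqrt (2.5 ^ 2) by rw [Real.sqrt_sq (by norm_num)]]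
    exact Real.sqrt_le_sqrt (by nlinarith)
  all_goals
    rw [Real.sqrt_le_left (by norm_num)]
    nlinarith

/-- `4 ≤ √u ≤ u/4` for `u ≥ 16`. [folklore] -/
theorem sqrt_bounds_of_sixteen_le {u : ℝ} (hu : 16 ≤ u) : 4 ≤ Real.sqrt u ∧ Real.sqrt u ≤ u / 4 := by
  have h4 : (4 : ℝ) = Real.sqrt 16 := by
    rw [show (16 : ℝ) = 4 ^ 2 by norm_num, Real.sqrt_sq (by norm_num)]
  have h1 : 4 ≤ Real.sqrt u := by rw [h4]; exact Real.sqrt_le_sqrt hu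
  refine ⟨h1, ?_⟩
  have hsq : Real.sqrt u * Real.sqrt u = u := Real.mul_self_sqrt (by linarith)
  nlinarith [Real.sqrt_nonneg u]

set_option maxHeartbeats 1600000 in
/-- **The tail error is `O(1/(α√φ u))`.** [cite: HildebrandTenenbaum1986, §4 (4.6)] -/
theorem tail_bound_le {α φ L u ℓ Tg W Td D ε : ℝ} (hα : 3 / 5 ≤ α) (hα1 : α ≤ 1) (hφ : 0 < φ)
    (hφup : φ ≤ 3 * u * L ^ 2) (hL : 1 ≤ L) (hu : 16 ≤ u) (hℓ : Real.exp ℓ = u) (hℓ1 : 1 ≤ ℓ)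
    (hTg : Tg = u / 4) (hW : W = Real.sqrt (140 * ℓ)) (hD : D = 4 * ℓ + 2 * Real.log L + 2) (hDu : D ≤ 7 * u)
    (hTd : Td = u / 2 * Real.sqrt D) (hε : ε = 1 / (u * L) ^ 3) :
    1 / α * Real.exp (-(W ^ 2 / 140)) * Real.sqrt (125 * Real.pi ^ 3 / φ) +
        10 * Real.pi * ε * (1 / α) / α + 2 * Real.pi * ε * (1 / α) * Td +
        2 * Real.pi * (4 * Tg ^ 2 * Real.exp (-1) * Real.exp (-(Td ^ 2 / (4 * Tg ^ 2)))) / Td ^ 2 ≤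
      100 * (1 / (α * Real.sqrt φ * u)) := by
  have hα0 : 0 < α := by linarith
  have hu0 : 0 < u := by linarith
  have hL0 : 0 < L := by linarith
  have hπ := Real.pi_lt_d2
  set sφ : ℝ := Real.sqrt φ with hsφ
  have hs0 : 0 < sφ := Real.sqrt_pos.2 hφ
  obtain ⟨-, -, -, -, hs3, hs7⟩ := sqrt_consts
  obtain ⟨hsu4, hsuu⟩ := sqrt_bounds_of_sixteen_le hu
  have hsu0 : 0 < Real.sqrt u := by linarith
  have hsφup : sφ ≤ Real.sqrt 3 * Real.sqrt u * L := by
    rw [hsφ, ← Real.sqrt_mul (by norm_num), show Real.sqrt (3 * u) * L = Real.sqrt (3 * u * L ^ 2) by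
      rw [Real.sqrt_mul (show (0 : ℝ) ≤ 3 * u by positivity) (L ^ 2), Real.sqrt_sq hL0.le]]
    exact Real.sqrt_le_sqrt (by nlinarith)
  have hsφup' : sφ ≤ 1.74 * Real.sqrt u * L := hsφup.trans (by gcongr)
  set ν : ℝ := 1 / (α * sφ * u) with hν
  have hν0 : 0 < ν := by positivity
  -- `ν ≥ 1/(1.74 u √u L)`
  have hνlo : 1 / (1.74 * u * Real.sqrt u * L) ≤ ν := by
    rw [hν]; apply one_div_le_one_div_of_le (by positivity)
    calc α * sφ * u ≤ 1 * (1.74 * Real.sqrt u * L) * u := by gcongr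
      _ = 1.74 * u * Real.sqrt u * L := by ring
  -- `ε ≤ ν/(64)`-type comparison: `ε · (1.74 u √u L) ≤ 1.74 √u/(u² L²) ≤ ...`
  have hε0 : 0 < ε := by rw [hε]; positivity
  have hεle : ε ≤ 1 / (u ^ 3 * L ^ 3) := by rw [hε, mul_pow]
  -- term 1: `e^{-W²/140} = 1/u`
  have hW2 : W ^ 2 / 140 = ℓ := by rw [hW, Real.sq_sqrt (by positivity)]; ring
  have hexpW : Real.exp (-(W ^ 2 / 140)) = 1 / u := by rw [hW2, Real.exp_neg, hℓ, one_div]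
  obtain ⟨-, h63⟩ := sqrt_pi_div_bounds hφ
  have ht1 : 1 / α * Real.exp (-(W ^ 2 / 140)) * Real.sqrt (125 * Real.pi ^ 3 / φ) ≤ 63 * ν := by
    rw [hexpW]
    calc 1 / α * (1 / u) * Real.sqrt (125 * Real.pi ^ 3 / φ) ≤ 1 / α * (1 / u) * (63 / sφ) := by gcongr
      _ = 63 * ν := by rw [hν]; field_simp
  -- term 2: `10π ε/α² ≤ 3ν`
  have ht2 : 10 * Real.pi * ε * (1 / α) / α ≤ 3 * ν := by
    -- `10π ε/α² ≤ 10π (25/9) ε` and `ε ≤ ν · (1.74 u√u L)/(u³L³) ≤ ν/36`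
    have h1 : 10 * Real.pi * ε * (1 / α) / α = 10 * Real.pi * ε / α ^ 2 := by field_simp
    rw [h1]
    have hα2 : 9 / 25 ≤ α ^ 2 := by nlinarith
    have h2 : 10 * Real.pi * ε / α ^ 2 ≤ 10 * Real.pi * ε / (9 / 25) :=
      div_le_div_of_nonneg_left (by positivity) (by norm_num) hα2
    have h3 : ε ≤ ν / 36 := by
      refine le_trans ?_ (div_le_div_of_nonneg_right hνlo (by norm_num))
      rw [hε, div_div, div_le_div_iff₀ (by positivity) (by positivity), one_mul, one_mul]
      -- `36 · 1.74 u √u L ≤ (uL)³`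
      have hL3 : L ≤ L ^ 3 := by nlinarith [one_le_pow₀ (n := 2) hL]
      have k1 : 36 * (1.74 * u * Real.sqrt u * L) ≤ 63 / 4 * u ^ 2 * L := by
        have := mul_le_mul_of_nonneg_left hsuu (by positivity : (0 : ℝ) ≤ u * L)
        nlinarith
      have k2 : 63 / 4 * u ^ 2 * L ≤ u * u ^ 2 * L ^ 3 :=
        mul_le_mul (mul_le_mul_of_nonneg_right (by linarith) (sq_nonneg u)) hL3 hL0.le (by positivity)
      calc 1.74 * u * Real.sqrt u * L * 36 = 36 * (1.74 * u * Real.sqrt u * L) := by ring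
        _ ≤ u * u ^ 2 * L ^ 3 := k1.trans k2
        _ = (u * L) ^ 3 := by ring
    have h4 : 10 * Real.pi * ε / (9 / 25) ≤ 10 * 3.15 * (ν / 36) / (9 / 25) := by gcongr
    linarith
  -- term 3: `2π ε Td/α ≤ 14ν`
  have hTdup : Td ≤ 2.65 / 2 * u * Real.sqrt u := by
    rw [hTd]
    have : Real.sqrt D ≤ Real.sqrt 7 * Real.sqrt u := by
      rw [← Real.sqrt_mul (by norm_num)]; exact Real.sqrt_le_sqrt hDu
    calc u / 2 * Real.sqrt D ≤ u / 2 * (Real.sqrt 7 * Real.sqrt u) := by gcongr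
      _ ≤ u / 2 * (2.65 * Real.sqrt u) := by gcongr
      _ = 2.65 / 2 * u * Real.sqrt u := by ring
  have hTd0 : 0 < Td := by
    rw [hTd]; have : 0 < Real.sqrt D := Real.sqrt_pos.2 (by rw [hD]; nlinarith [Real.log_nonneg hL]); positivity
  have hεTd : ε * Td ≤ 3 * ν := by
    refine le_trans ?_ (mul_le_mul_of_nonneg_left hνlo (by norm_num))
    calc ε * Td ≤ 1 / (u ^ 3 * L ^ 3) * (2.65 / 2 * u * Real.sqrt u) := by gcongr
      _ ≤ 3 * (1 / (1.74 * u * Real.sqrt u * L)) := by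
          rw [div_mul_eq_mul_div, one_mul, mul_one_div, div_le_div_iff₀ (by positivity) (by positivity)]
          -- `(1.325 u √u)(1.74 u √u L) ≤ 3 u³ L³`: `√u √u = u`, `L ≤ L³`
          have hsq : Real.sqrt u * Real.sqrt u = u := Real.mul_self_sqrt hu0.le
          have hL3 : L ≤ L ^ 3 := by nlinarith [one_le_pow₀ (n := 2) hL]
          have : 2.65 / 2 * u * Real.sqrt u * (1.74 * u * Real.sqrt u * L) = 2.3055 * u ^ 3 * L := by
            rw [show 2.65 / 2 * u * Real.sqrt u * (1.74 * u * Real.sqrt u * L) =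
              2.3055 * u ^ 2 * (Real.sqrt u * Real.sqrt u) * L by ring, hsq]; ring
          rw [this]
          have h0' : 0 ≤ u ^ 3 * L := by positivity
          have h1 := mul_le_mul_of_nonneg_left hL3 (by positivity : (0 : ℝ) ≤ u ^ 3)
          linarith
  have ht3 : 2 * Real.pi * ε * (1 / α) * Td ≤ 32 * ν := by
    have h1 : 2 * Real.pi * ε * (1 / α) * Td = 2 * Real.pi / α * (ε * Td) := by field_simp
    rw [h1]
    have h2 : 2 * Real.pi / α ≤ 2 * 3.15 / (3 / 5) := by
      gcongr
    calc 2 * Real.pi / α * (ε * Td) ≤ 2 * 3.15 / (3 / 5) * (3 * ν) := by gcongr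
      _ ≤ 32 * ν := by nlinarith
  -- term 4: `B₃ = 4T_g² e^{-1} e^{-D}`, `e^{-D} = e^{-2}/(u⁴ L²)`, `T_d² ≥ u²`
  have hTg0 : 0 < Tg := by rw [hTg]; linarith
  have hD4 : 4 ≤ D := by rw [hD]; nlinarith [Real.log_nonneg hL]
  have hTdTg : Td ^ 2 / (4 * Tg ^ 2) = D := by
    rw [hTd, hTg, mul_pow, Real.sq_sqrt (by linarith)]; field_simp; ring
  have hexpD : Real.exp (-D) = Real.exp (-2) / (u ^ 4 * L ^ 2) := by
    rw [hD, show -(4 * ℓ + 2 * Real.log L + 2) = -2 + (-(4 * ℓ)) + (-(2 * Real.log L)) by ring, Real.exp_add,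
      Real.exp_add, Real.exp_neg (4 * ℓ), Real.exp_neg (2 * Real.log L),
      show 4 * ℓ = (4 : ℕ) * ℓ by norm_num, Real.exp_nat_mul, hℓ,
      show 2 * Real.log L = (2 : ℕ) * Real.log L by norm_num, Real.exp_nat_mul, Real.exp_log hL0]
    field_simp
  have hTdsq : u ^ 2 ≤ Td ^ 2 := by
    have h2 : 2 ≤ Real.sqrt D := by
      rw [show (2 : ℝ) = Real.sqrt 4 by rw [show (4 : ℝ) = 2 ^ 2 by norm_num, Real.sqrt_sq (by norm_num)]]
      exact Real.sqrt_le_sqrt hD4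
    have : u ≤ Td := by rw [hTd]; nlinarith
    exact pow_le_pow_left₀ hu0.le this 2
  have ht4 : 2 * Real.pi * (4 * Tg ^ 2 * Real.exp (-1) * Real.exp (-(Td ^ 2 / (4 * Tg ^ 2)))) / Td ^ 2 ≤ 1 * ν := by
    rw [hTdTg, hexpD, one_mul]
    refine le_trans ?_ hνlo
    have he1 : Real.exp (-1) ≤ 1 := Real.exp_le_one_iff.2 (by norm_num)
    have he2 : Real.exp (-2) ≤ 1 := Real.exp_le_one_iff.2 (by norm_num)
    rw [div_le_div_iff₀ (by positivity) (by positivity), one_mul, hTg]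
    -- `2π · 4 (u/4)² e^{-1} e^{-2}/(u⁴L²) · 1.74 u √u L ≤ T_d²`, and `T_d² ≥ u²`
    have hsq : Real.sqrt u ≤ u / 4 := hsuu
    have k1 : 2 * Real.pi * (4 * (u / 4) ^ 2 * Real.exp (-1) * (Real.exp (-2) / (u ^ 4 * L ^ 2))) *
        (1.74 * u * Real.sqrt u * L) ≤ 2 * 3.15 * (4 * (u / 4) ^ 2 * 1 * (1 / (u ^ 4 * L ^ 2))) *
        (1.74 * u * (u / 4) * L) := by
      gcongr
    refine k1.trans (le_trans ?_ hTdsq)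
    rw [show 2 * 3.15 * (4 * (u / 4) ^ 2 * 1 * (1 / (u ^ 4 * L ^ 2))) * (1.74 * u * (u / 4) * L) =
      0.685125 / L by field_simp; ring]
    rw [div_le_iff₀ hL0]
    nlinarith
  linarith [ht1, ht2, ht3, ht4]

set_option maxHeartbeats 1600000 in
/-- **The Gaussian mean of `|ζ|` is `O(m/u)`**, `m = ζ(α, y)/(α√(2πφ))`. [cite: HildebrandTenenbaum1986, §4 (4.6)] -/
theorem mean_bound_le {α φ L u ℓ Tg Td D ε ζ₀ : ℝ} (hα : 3 / 5 ≤ α) (hα1 : α ≤ 1) (hφ : 0 < φ)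
    (hφup : φ ≤ 3 * u * L ^ 2) (hL : 1 ≤ L) (hu : 16 ≤ u) (hℓ : Real.exp ℓ = u) (hℓ1 : 1 ≤ ℓ)
    (hTg : Tg = u / 4) (hD : D = 4 * ℓ + 2 * Real.log L + 2) (hDu : D ≤ 7 * u)
    (hTd : Td = u / 2 * Real.sqrt D) (hε : ε = 1 / (u * L) ^ 3) (hζ : 0 ≤ ζ₀) :
    4 * Real.sqrt (2 * Real.pi) / Tg * (1 / (2 * Real.pi) * (ζ₀ * (Real.sqrt (Real.pi / (φ / 100)) +
        ε * (2 * Td) + Real.exp (-(Td ^ 2 / Tg ^ 2)) * Real.sqrt (Real.pi / (1 / Tg ^ 2))))) ≤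
      400 / u * (ζ₀ / (α * Real.sqrt (2 * Real.pi * φ))) := by
  have hα0 : 0 < α := by linarith
  have hu0 : 0 < u := by linarith
  have hL0 : 0 < L := by linarith
  have hπ := Real.pi_lt_d2
  have hπ3 := Real.pi_gt_three
  set sφ : ℝ := Real.sqrt φ with hsφ
  have hs0 : 0 < sφ := Real.sqrt_pos.2 hφ
  obtain ⟨hs2πlo, hs2π, hsπ, hs100, hs3, hs7⟩ := sqrt_consts
  obtain ⟨hsu4, hsuu⟩ := sqrt_bounds_of_sixteen_le hu
  have hsu0 : 0 < Real.sqrt u := by linarith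
  have hsqu : Real.sqrt u * Real.sqrt u = u := Real.mul_self_sqrt hu0.le
  have hsφup : sφ ≤ 1.74 * Real.sqrt u * L := by
    have : sφ ≤ Real.sqrt 3 * Real.sqrt u * L := by
      rw [hsφ, ← Real.sqrt_mul (by norm_num), show Real.sqrt (3 * u) * L = Real.sqrt (3 * u * L ^ 2) by
        rw [Real.sqrt_mul (show (0 : ℝ) ≤ 3 * u by positivity) (L ^ 2), Real.sqrt_sq hL0.le]]
      exact Real.sqrt_le_sqrt (by nlinarith)
    exact this.trans (by gcongr)
  have hTg0 : 0 < Tg := by rw [hTg]; linarith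
  have hD4 : 4 ≤ D := by rw [hD]; nlinarith [Real.log_nonneg hL]
  have hD0 : 0 < D := by linarith
  have hTd0 : 0 < Td := by rw [hTd]; have := Real.sqrt_pos.2 hD0; positivity
  have hε0 : 0 < ε := by rw [hε]; positivity
  -- the three bracket terms, each multiplied by `sφ`
  set S : ℝ := Real.sqrt (Real.pi / (φ / 100)) + ε * (2 * Td) +
    Real.exp (-(Td ^ 2 / Tg ^ 2)) * Real.sqrt (Real.pi / (1 / Tg ^ 2)) with hS
  have hb1 : Real.sqrt (Real.pi / (φ / 100)) * sφ ≤ 18 := by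
    rw [show Real.pi / (φ / 100) = 100 * Real.pi / φ by field_simp, Real.sqrt_div' _ hφ.le, ← hsφ,
      div_mul_cancel₀ _ hs0.ne']
    exact hs100
  have hTdup : Td ≤ 2.65 / 2 * u * Real.sqrt u := by
    rw [hTd]
    have : Real.sqrt D ≤ Real.sqrt 7 * Real.sqrt u := by
      rw [← Real.sqrt_mul (by norm_num)]; exact Real.sqrt_le_sqrt hDu
    calc u / 2 * Real.sqrt D ≤ u / 2 * (Real.sqrt 7 * Real.sqrt u) := by gcongr
      _ ≤ u / 2 * (2.65 * Real.sqrt u) := by gcongr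
      _ = 2.65 / 2 * u * Real.sqrt u := by ring
  have hb2 : ε * (2 * Td) * sφ ≤ 0.3 := by
    calc ε * (2 * Td) * sφ ≤ 1 / (u * L) ^ 3 * (2 * (2.65 / 2 * u * Real.sqrt u)) * (1.74 * Real.sqrt u * L) := by
          rw [hε]; gcongr
      _ = 4.611 * (Real.sqrt u * Real.sqrt u) * u * L / (u ^ 3 * L ^ 3) := by field_simp; ring
      _ = 4.611 / (u * L ^ 2) := by
          rw [hsqu, div_eq_div_iff (by positivity) (by positivity)]; ring
      _ ≤ 0.3 := by
          rw [div_le_iff₀ (by positivity)]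
          have := mul_le_mul hu (one_le_pow₀ (n := 2) hL) zero_le_one hu0.le
          linarith
  have hexpD : Real.exp (-(Td ^ 2 / Tg ^ 2)) ≤ Real.exp (-2) / (u ^ 4 * L ^ 2) := by
    have h4D : Td ^ 2 / Tg ^ 2 = 4 * D := by
      rw [hTd, hTg, mul_pow, Real.sq_sqrt hD0.le]; field_simp; ring
    have hexpD' : Real.exp (-D) = Real.exp (-2) / (u ^ 4 * L ^ 2) := by
      rw [hD, show -(4 * ℓ + 2 * Real.log L + 2) = -2 + (-(4 * ℓ)) + (-(2 * Real.log L)) by ring, Real.exp_add,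
        Real.exp_add, Real.exp_neg (4 * ℓ), Real.exp_neg (2 * Real.log L),
        show 4 * ℓ = (4 : ℕ) * ℓ by norm_num, Real.exp_nat_mul, hℓ,
        show 2 * Real.log L = (2 : ℕ) * Real.log L by norm_num, Real.exp_nat_mul, Real.exp_log hL0]
      field_simp
    rw [h4D, ← hexpD']
    exact Real.exp_le_exp.2 (by linarith)
  have hb3 : Real.exp (-(Td ^ 2 / Tg ^ 2)) * Real.sqrt (Real.pi / (1 / Tg ^ 2)) * sφ ≤ 0.01 := by
    have hsq : Real.sqrt (Real.pi / (1 / Tg ^ 2)) = Real.sqrt Real.pi * Tg := by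
      rw [show Real.pi / (1 / Tg ^ 2) = Real.pi * Tg ^ 2 by field_simp, Real.sqrt_mul Real.pi_pos.le,
        Real.sqrt_sq hTg0.le]
    have he2 : Real.exp (-2) ≤ 1 := Real.exp_le_one_iff.2 (by norm_num)
    rw [hsq]
    calc Real.exp (-(Td ^ 2 / Tg ^ 2)) * (Real.sqrt Real.pi * Tg) * sφ
        ≤ Real.exp (-2) / (u ^ 4 * L ^ 2) * (1.78 * Tg) * (1.74 * Real.sqrt u * L) := by gcongr
      _ ≤ 1 / (u ^ 4 * L ^ 2) * (1.78 * Tg) * (1.74 * (u / 4) * L) := by gcongr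
      _ = 0.193575 / (u ^ 2 * L) := by rw [hTg]; field_simp; ring
      _ ≤ 0.01 := by
          rw [div_le_iff₀ (by positivity)]
          have h1 : (16 : ℝ) * 1 ≤ u * L := mul_le_mul hu hL (by norm_num) hu0.le
          have h2 : (16 : ℝ) * (16 * 1) ≤ u * (u * L) := mul_le_mul hu h1 (by norm_num) hu0.le
          nlinarith
  have hSs : S * sφ ≤ 18.31 := by
    have : S * sφ = Real.sqrt (Real.pi / (φ / 100)) * sφ + ε * (2 * Td) * sφ +
        Real.exp (-(Td ^ 2 / Tg ^ 2)) * Real.sqrt (Real.pi / (1 / Tg ^ 2)) * sφ := by rw [hS]; ring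
    linarith [hb1, hb2, hb3]
  have hS0 : 0 ≤ S := by positivity
  -- assemble: `LHS = (16√(2π)/(2πu)) ζ₀ S`, `m = ζ₀/(α √(2π) sφ)`
  have hsqrt2πφ : Real.sqrt (2 * Real.pi * φ) = Real.sqrt (2 * Real.pi) * sφ := Real.sqrt_mul (by positivity) φ
  rw [hsqrt2πφ, hTg]
  have hs2π0 : 0 < Real.sqrt (2 * Real.pi) := by linarith
  rw [show 4 * Real.sqrt (2 * Real.pi) / (u / 4) * (1 / (2 * Real.pi) * (ζ₀ * S)) =
      (8 * Real.sqrt (2 * Real.pi) / Real.pi) * (ζ₀ * S) / u by field_simp; ring,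
    show 400 / u * (ζ₀ / (α * (Real.sqrt (2 * Real.pi) * sφ))) = 400 * (ζ₀ / (α * (Real.sqrt (2 * Real.pi) * sφ))) / u by
      field_simp]
  refine div_le_div_of_nonneg_right ?_ hu0.le
  rw [mul_div_assoc', le_div_iff₀ (by positivity)]
  -- `(8√(2π)/π) ζ₀ S (α √(2π) sφ) ≤ 400 ζ₀`: `8√(2π)/π ≤ 6.7`, `S sφ ≤ 18.31`, `α √(2π) ≤ 2.6`
  have h1 : 8 * Real.sqrt (2 * Real.pi) / Real.pi ≤ 7 := by
    rw [div_le_iff₀ Real.pi_pos]; nlinarith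
  have h2 : S * (α * (Real.sqrt (2 * Real.pi) * sφ)) ≤ 18.31 * 2.6 := by
    calc S * (α * (Real.sqrt (2 * Real.pi) * sφ)) = (α * Real.sqrt (2 * Real.pi)) * (S * sφ) := by ring
      _ ≤ (1 * 2.6) * 18.31 := by
          refine mul_le_mul (mul_le_mul hα1 hs2π hs2π0.le zero_le_one) hSs (mul_nonneg hS0 hs0.le)
            (by norm_num)
      _ = 18.31 * 2.6 := by ring
  calc 8 * Real.sqrt (2 * Real.pi) / Real.pi * (ζ₀ * S) * (α * (Real.sqrt (2 * Real.pi) * sφ))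
      = (8 * Real.sqrt (2 * Real.pi) / Real.pi) * ζ₀ * (S * (α * (Real.sqrt (2 * Real.pi) * sφ))) := by ring
    _ ≤ 7 * ζ₀ * (18.31 * 2.6) := by gcongr
    _ ≤ 400 * ζ₀ := by nlinarith

end GaussSaddle

end Literature.NumberTheory.Sieve

end
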